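import Summits.NavierStokesRegularity.NavierStokesRegularity.Theorems.PerpetualPumpAveragedTypeIBlowupLinearComparison
import Mathlib.Analysis.SpecialFunctions.Integrals.Basic

/-!
# Crux `PerpetualPump.AveragedTypeIBlowup` (stmt-NavierStokesRegularity-1835), line `Sketch`:
# assembly tools for the window one-step theorem (lead c1)

Mathlib + the landed `stub_linearComparison` file. Time rescaling to the slow time `σ = R (t − t₀)` of the front
scale (derivatives, integrals, the Duhamel restart inequality of the majorants) and a crude two-sided exponential
growth bound `|y' − K y| ≤ g, K ≤ K₊ ⇒ |y(σ)| ≤ e^{K₊σ}(|y(0)| + ∫₀^σ g)` (used for the seed of the next bond).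
-/

noncomputable section
-- the summit namespace `…NavierStokesRegularity.NavierStokesRegularity…` is the tree convention
set_option linter.dupNamespace false

open Set MeasureTheory Filter Topology intervalIntegral

namespace Summit.NavierStokesRegularity.NavierStokesRegularity.Theorems.PerpetualPumpAveragedTypeIBlowup

/-- Derivative under the affine time change `t = t₀ + σ / R`. [folklore] -/
theorem hasDerivAt_rescale {f : ℝ → ℝ} {f' t₀ R σ : ℝ}
    (h : HasDerivAt f f' (t₀ + σ / R)) :
    HasDerivAt (fun s : ℝ => f (t₀ + s / R)) (f' / R) σ := by
  have hlin : HasDerivAt (fun s : ℝ => t₀ + s / R) (1 / R) σ := by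
    simpa using ((hasDerivAt_id σ).div_const R).const_add t₀
  have h2 := h.comp σ hlin
  have heq : f' * (1 / R) = f' / R := by ring
  rw [heq] at h2
  exact h2

/-- The substitution `u = t₀ + v/R`: `∫_{t₀+σ₁/R}^{t₀+σ₂/R} R h(u) du = ∫_{σ₁}^{σ₂} h(t₀ + v/R) dv`. [folklore] -/
theorem integral_rescale (h : ℝ → ℝ) {t₀ R : ℝ} (hR : R ≠ 0) (σ₁ σ₂ : ℝ) :
    ∫ u in (t₀ + σ₁ / R)..(t₀ + σ₂ / R), R * h u = ∫ v in σ₁..σ₂, h (t₀ + v / R) := by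
  have h1 := intervalIntegral.integral_comp_add_div (fun s => R * h s) hR t₀ (a := σ₁) (b := σ₂)
  simp only [smul_eq_mul] at h1
  have h3 : ∫ x in σ₁..σ₂, R * h (t₀ + x / R) = R * ∫ v in σ₁..σ₂, h (t₀ + v / R) := by
    rw [← intervalIntegral.integral_const_mul]
  rw [h3] at h1
  exact (mul_right_injective₀ hR h1).symm

/-- Continuity under the time change. [folklore] -/
theorem continuousOn_rescale {f : ℝ → ℝ} {t₀ R a b : ℝ} (hR : 0 < R)
    (h : ContinuousOn f (Icc t₀ (t₀ + b / R))) (ha : 0 ≤ a) :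
    ContinuousOn (fun s : ℝ => f (t₀ + s / R)) (Icc a b) := by
  refine h.comp (by fun_prop) ?_
  intro s hs
  constructor
  · have : 0 ≤ s / R := div_nonneg (ha.trans hs.1) hR.le
    linarith
  · have : s / R ≤ b / R := div_le_div_of_nonneg_right hs.2 hR.le
    linarith

/-- The Duhamel restart inequality of a majorant in slow time. [folklore] -/
theorem restart_rescale {M G : ℝ → ℝ} {t₀ R θ σ₁ σ₂ : ℝ} (hR : 0 < R)
    (h : M (t₀ + σ₂ / R) ≤ M (t₀ + σ₁ / R) * Real.exp (-(θ * R * ((t₀ + σ₂ / R) - (t₀ + σ₁ / R)))) +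
      R * ∫ u in (t₀ + σ₁ / R)..(t₀ + σ₂ / R), Real.exp (-(θ * R * ((t₀ + σ₂ / R) - u))) * |G u|) :
    M (t₀ + σ₂ / R) ≤ M (t₀ + σ₁ / R) * Real.exp (-(θ * (σ₂ - σ₁))) +
      ∫ v in σ₁..σ₂, Real.exp (-(θ * (σ₂ - v))) * |G (t₀ + v / R)| := by
  have hR0 : R ≠ 0 := hR.ne'
  have e1 : θ * R * ((t₀ + σ₂ / R) - (t₀ + σ₁ / R)) = θ * (σ₂ - σ₁) := by
    field_simp
    ring
  have e2 : R * ∫ u in (t₀ + σ₁ / R)..(t₀ + σ₂ / R), Real.exp (-(θ * R * ((t₀ + σ₂ / R) - u))) * |G u| =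
      ∫ v in σ₁..σ₂, Real.exp (-(θ * (σ₂ - v))) * |G (t₀ + v / R)| := by
    rw [← intervalIntegral.integral_const_mul]
    rw [show (fun u => R * (Real.exp (-(θ * R * ((t₀ + σ₂ / R) - u))) * |G u|)) =
        fun u => R * (fun u' => Real.exp (-(θ * R * ((t₀ + σ₂ / R) - u'))) * |G u'|) u from rfl]
    rw [integral_rescale (fun u' => Real.exp (-(θ * R * ((t₀ + σ₂ / R) - u'))) * |G u'|) hR0 σ₁ σ₂]
    refine intervalIntegral.integral_congr fun v _ => ?_
    have : θ * R * ((t₀ + σ₂ / R) - (t₀ + v / R)) = θ * (σ₂ - v) := by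
      field_simp
      ring
    simp only [this]
  rw [e1, e2] at h
  exact h

/-- **Crude exponential growth bound** (two-sided): if `|y' − K y| ≤ g` on `(0,σ₁)` with `K ≤ K₊` (`K₊ ≥ 0`), `g ≥ 0`,
all continuous on `[0,σ₁]`, then `|y(σ)| ≤ e^{K₊σ}(|y(0)| + ∫₀^σ g)`. [folklore] -/
theorem abs_le_exp_growth :
    ∀ {y K g : ℝ → ℝ} {Kp σ₁ : ℝ}, 0 ≤ Kp → ContinuousOn K (Icc 0 σ₁) → ContinuousOn g (Icc 0 σ₁) →
      ContinuousOn y (Icc 0 σ₁) → (∀ σ ∈ Icc 0 σ₁, K σ ≤ Kp) → (∀ σ ∈ Icc 0 σ₁, 0 ≤ g σ) →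
      (∀ σ ∈ Ioo 0 σ₁, ∃ y' : ℝ, HasDerivAt y y' σ ∧ |y' - K σ * y σ| ≤ g σ) →
      ∀ σ ∈ Icc 0 σ₁, |y σ| ≤ Real.exp (Kp * σ) * (|y 0| + ∫ u in (0 : ℝ)..σ, g u) := by
  intro y K g Kp σ₁ hKp hK hg hy hKle hg0 hode σ hσ
  have h01 : (0 : ℝ) ≤ σ₁ := hσ.1.trans hσ.2
  -- upper and lower integrating-factor bounds
  have hdu : ∀ t ∈ Ioo 0 σ₁, ∃ x' : ℝ, HasDerivAt y x' t ∧ x' ≤ K t * y t + g t := by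
    intro t ht
    obtain ⟨y', hy', hb⟩ := hode t ht
    exact ⟨y', hy', by linarith [(abs_le.1 hb).2]⟩
  have hdl : ∀ t ∈ Ioo 0 σ₁, ∃ x' : ℝ, HasDerivAt y x' t ∧ K t * y t + (-g t) ≤ x' := by
    intro t ht
    obtain ⟨y', hy', hb⟩ := hode t ht
    exact ⟨y', hy', by linarith [(abs_le.1 hb).1]⟩
  have hup := linearComparison_upper h01 hK hg hy hdu hσ
  have hlo := linearComparison_lower h01 hK hg.neg hy hdl hσ
  -- bounds on the integrating factors
  have hIK : ∫ s in (0 : ℝ)..σ, K s ≤ Kp * σ := by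
    have h1 : ∫ s in (0 : ℝ)..σ, K s ≤ ∫ _ in (0 : ℝ)..σ, Kp :=
      intervalIntegral.integral_mono_on hσ.1
        ((hK.mono (Icc_subset_Icc_right hσ.2)).intervalIntegrable_of_Icc hσ.1)
        (continuousOn_const.intervalIntegrable_of_Icc hσ.1)
        fun s hs => hKle s ⟨hs.1, hs.2.trans hσ.2⟩
    simpa [mul_comm] using h1
  have hΦ : Real.exp (∫ s in (0 : ℝ)..σ, K s) ≤ Real.exp (Kp * σ) := Real.exp_le_exp.2 hIK
  -- the weighted forcing integral: e^{∫₀^σ K} ∫₀^σ e^{-∫₀^u K} g ≤ e^{Kp σ} ∫₀^σ g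
  have hinner : ∀ u ∈ Icc 0 σ, Real.exp (∫ s in (0 : ℝ)..σ, K s) * Real.exp (-(∫ s in (0 : ℝ)..u, K s)) ≤
      Real.exp (Kp * σ) := by
    intro u hu
    rw [← Real.exp_add, Real.exp_le_exp]
    have hsplit : (∫ s in (0 : ℝ)..σ, K s) - ∫ s in (0 : ℝ)..u, K s = ∫ s in u..σ, K s := by
      rw [intervalIntegral.integral_interval_sub_left
        ((hK.mono (Icc_subset_Icc_right hσ.2)).intervalIntegrable_of_Icc hσ.1)
        ((hK.mono (Icc_subset_Icc_right (hu.2.trans hσ.2))).intervalIntegrable_of_Icc hu.1)]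
    have hle : ∫ s in u..σ, K s ≤ ∫ _ in u..σ, Kp :=
      intervalIntegral.integral_mono_on hu.2
        ((hK.mono (Icc_subset_Icc hu.1 hσ.2)).intervalIntegrable_of_Icc hu.2)
        (continuousOn_const.intervalIntegrable_of_Icc hu.2)
        fun s hs => hKle s ⟨hu.1.trans hs.1, hs.2.trans hσ.2⟩
    have hc : ∫ _ in u..σ, Kp = Kp * (σ - u) := by simp [mul_comm]
    have hKpu : Kp * (σ - u) ≤ Kp * σ := by nlinarith [hu.1]
    linarith [hsplit.symm.le, hsplit.le]
  -- |∫ e^{-∫K} g| ≤ ∫ e^{-∫K} g and the product bound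
  set W : ℝ → ℝ := fun u => Real.exp (-(∫ s in (0 : ℝ)..u, K s)) * g u with hW
  have hWc : ContinuousOn W (Icc 0 σ) := by
    obtain ⟨hPc, -⟩ := linearComparison_primitive (hσ.1.trans hσ.2 |> fun _ => hσ.1.trans hσ.2) hK
    · exact ((hPc.mono (Icc_subset_Icc_right hσ.2)).neg.rexp).mul (hg.mono (Icc_subset_Icc_right hσ.2))
  have hW0 : ∀ u ∈ Icc 0 σ, 0 ≤ W u := fun u hu =>
    mul_nonneg (Real.exp_pos _).le (hg0 u ⟨hu.1, hu.2.trans hσ.2⟩)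
  have hprod : Real.exp (∫ s in (0 : ℝ)..σ, K s) * ∫ u in (0 : ℝ)..σ, W u ≤
      Real.exp (Kp * σ) * ∫ u in (0 : ℝ)..σ, g u := by
    rw [← intervalIntegral.integral_const_mul, ← intervalIntegral.integral_const_mul]
    refine intervalIntegral.integral_mono_on hσ.1 ?_ ?_ fun u hu => ?_
    · exact (continuousOn_const.mul hWc).intervalIntegrable_of_Icc hσ.1
    · exact (continuousOn_const.mul (hg.mono (Icc_subset_Icc_right hσ.2))).intervalIntegrable_of_Icc hσ.1
    · have hu' : u ∈ Icc 0 σ := hu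
      calc Real.exp (∫ s in (0 : ℝ)..σ, K s) * W u
          = (Real.exp (∫ s in (0 : ℝ)..σ, K s) * Real.exp (-(∫ s in (0 : ℝ)..u, K s))) * g u := by
            rw [hW]; ring
        _ ≤ Real.exp (Kp * σ) * g u :=
            mul_le_mul_of_nonneg_right (hinner u hu') (hg0 u ⟨hu'.1, hu'.2.trans hσ.2⟩)
  have hWint_nonneg : 0 ≤ ∫ u in (0 : ℝ)..σ, W u :=
    intervalIntegral.integral_nonneg hσ.1 fun u hu => hW0 u hu
  have hgint_nonneg : 0 ≤ ∫ u in (0 : ℝ)..σ, g u :=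
    intervalIntegral.integral_nonneg hσ.1 fun u hu => hg0 u ⟨hu.1, hu.2.trans hσ.2⟩
  -- combine
  have hE0 := Real.exp_pos (∫ s in (0 : ℝ)..σ, K s)
  have hneg : ∫ u in (0 : ℝ)..σ, Real.exp (-(∫ s in (0 : ℝ)..u, K s)) * (-g) u = -∫ u in (0 : ℝ)..σ, W u := by
    rw [← intervalIntegral.integral_neg]
    refine intervalIntegral.integral_congr fun u _ => ?_
    simp [hW]
  rw [hneg] at hlo
  have hA1 : Real.exp (∫ s in (0 : ℝ)..σ, K s) * y 0 ≤ Real.exp (Kp * σ) * |y 0| :=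
    calc Real.exp (∫ s in (0 : ℝ)..σ, K s) * y 0 ≤ Real.exp (∫ s in (0 : ℝ)..σ, K s) * |y 0| :=
          mul_le_mul_of_nonneg_left (le_abs_self _) hE0.le
      _ ≤ Real.exp (Kp * σ) * |y 0| := mul_le_mul_of_nonneg_right hΦ (abs_nonneg _)
  have hA2 : -(Real.exp (Kp * σ) * |y 0|) ≤ Real.exp (∫ s in (0 : ℝ)..σ, K s) * y 0 :=
    calc -(Real.exp (Kp * σ) * |y 0|) ≤ -(Real.exp (∫ s in (0 : ℝ)..σ, K s) * |y 0|) := by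
          have := mul_le_mul_of_nonneg_right hΦ (abs_nonneg (y 0)); linarith
      _ ≤ Real.exp (∫ s in (0 : ℝ)..σ, K s) * y 0 := by
          have := mul_le_mul_of_nonneg_left (neg_abs_le (y 0)) hE0.le; linarith
  have hup' : y σ ≤ Real.exp (Kp * σ) * (|y 0| + ∫ u in (0 : ℝ)..σ, g u) := by
    have h1 : Real.exp (∫ s in (0 : ℝ)..σ, K s) * (y 0 + ∫ u in (0 : ℝ)..σ, W u) ≤
        Real.exp (Kp * σ) * |y 0| + Real.exp (Kp * σ) * ∫ u in (0 : ℝ)..σ, g u := by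
      rw [mul_add]; linarith [hA1, hprod]
    have h2 : y σ ≤ Real.exp (∫ s in (0 : ℝ)..σ, K s) * (y 0 + ∫ u in (0 : ℝ)..σ, W u) := hup
    rw [mul_add]
    linarith
  have hlo' : -(Real.exp (Kp * σ) * (|y 0| + ∫ u in (0 : ℝ)..σ, g u)) ≤ y σ := by
    have hb : -(Real.exp (Kp * σ) * ∫ u in (0 : ℝ)..σ, g u) ≤
        Real.exp (∫ s in (0 : ℝ)..σ, K s) * -∫ u in (0 : ℝ)..σ, W u := by
      have : Real.exp (∫ s in (0 : ℝ)..σ, K s) * -∫ u in (0 : ℝ)..σ, W u =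
          -(Real.exp (∫ s in (0 : ℝ)..σ, K s) * ∫ u in (0 : ℝ)..σ, W u) := by ring
      rw [this]; linarith [hprod]
    have h1 : -(Real.exp (Kp * σ) * |y 0|) - Real.exp (Kp * σ) * ∫ u in (0 : ℝ)..σ, g u ≤
        Real.exp (∫ s in (0 : ℝ)..σ, K s) * (y 0 + -∫ u in (0 : ℝ)..σ, W u) := by
      rw [mul_add]; linarith [hA2, hb]
    have h2 : Real.exp (∫ s in (0 : ℝ)..σ, K s) * (y 0 + -∫ u in (0 : ℝ)..σ, W u) ≤ y σ := hlo
    rw [mul_add]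
    linarith
  exact abs_le.2 ⟨by linarith, hup'⟩

end Summit.NavierStokesRegularity.NavierStokesRegularity.Theorems.PerpetualPumpAveragedTypeIBlowup

end
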